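import Summits.ABC.IUTFork.Conditional.WRowHexLamSevenTriplesC
import Summits.ABC.IUTFork.Conditional.WRowUnconditionalCellsSlot
import Summits.ABC.IUTFork.Conditional.InhUniformBandCells
import Summits.ABC.IUTFork.Cor312LicenceTripleUnconditionalCeil
import HarnessLib

/-!
# R-W «OPEN-SINGLE-PRIMES» — the HEX family `λ_k = 1/2 + 2/7^k` at `k = 10`, the SINGLE LEVEL `l = 4723`: the hull licence S_H HOLDS at EVERY
# genuine Θ-volume datum over `(ratPoint λ_10, 4723)`, unconditionally — the last prime of the `k = 10` axis, decided by the CEILING inner slot at `7`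

PROOF-ONLY file (D-0012; 0 definitions, 0 `Prop` facts) of the abc-iut cell — D-0079 RESCUE sub-cell R-W «WINDOW Θ-SIDE INEQUALITY», seat
abc-iut-W-neg-1 (gen 5), row «OPEN-SINGLE-PRIMES» (abc-iut-plan C-R105 (a); KEY `wake/KEY-abc-iut-W-neg-1-OPENSINGLEPRIMES.md`). abc-iut-C-cert-1 (gen 8)
decided the HEX class `k = 10` at every prime `l ≥ 11` EXCEPT `l = 4723`: ¬S_H ∀T for `11 ≤ l ≤ 4721` (p508090 `WRowHexLamSevenTenRefutedBand`), S_H ∀T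
for every prime `l ≥ 4729` (p507080 `WRow.licence_lamSeven_ten_all`, abc-iut-W-row-1's INTEGER-SLOT triple socket). At `l = 4723` the exact cell over the
binding prime `7` (`e = 3·l·n`; `n = 1`, `e = 14169`, `6 ∤ e`) FAILS at the top label `j = 2361` under the integer slot `⌊e/6⌋ = 2361` and HOLDS under
the CEILING `⌈e/6⌉ = 2362` (abc-iut-W-num-5 ENGINEC-CEIL-ONLY-LEVELS.tsv a14426db4c9d93ee; this seat's desk work/desk7.py, exact integers: under `2362`
the exact cell holds at all `2361` labels, the floor-free form fails only at the top one). The licence socket's inner radius is a FREE binder with a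
witness obligation; this seat's `WRow.inner_witness_ceil` (p511165) supplies the ceiling for every `ℚ_7`-field, packaged as the CEILING-slot triple
socket `WRow.licence_triple_unconditional_ceil` (`Cor312LicenceTripleUnconditionalCeil`). THIS FILE discharges that socket's arithmetic hypothesis at
`l = 4723` for the Frey–Legendre triple `282475253 + 282475245 = 564950498` of `λ_10` (abc-iut-C-cert-1's `WRowHexLamSevenTriplesC`: `isABCTriple_hex10`,
`lamSeven_eq_hex10`, `eq_of_prime_dvd_triple_hex10`, `factorization_triple_hex10`): per bad prime `p ∈ {3, 5, 13, 113, 431, 3361, 2499781}` the cells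
certified under the integer slot (`WRow.cell_wild_of_ends` / `WRow.cell_tameslot_of_ends`, two numeric end labels at `L = 2361`) transport to the
ceiling by `WRow.cell_of_le_rin` + `WRow.max_one_div_le_ceilSlot`; over `7`: `n ≥ 2` floor-free from `n₀ = 2` (slot, transported), `n = 1` the level
lemma `WRow.cell_hex10_p7_one_4723` (interior labels by `InhBand.quad_nonpos_of_ends 30 (−70805) (−56667) · 4721`, the EXACT top-label cell incl. the
floor by `norm_num`). TAKES NO SIDE on [IUTchIII] Cor. 3.12 (S. Mochizuki, *Inter-universal Teichmüller theory III*, Cor. 3.12 p. 173–174; Step (xi-f)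
p. 184) or on any author; «inhabited as typed» ≠ «asserted in print».

WHAT IS PROVED (namespace `Summit.ABC.IUTFork.Conditional`): `WRow.cell_hex10_p7_one_4723`, `WRow.hcell_lamSeven_ten_ceil_4723` (the arithmetic at
`l = 4723`, ceiling slot), **`WRow.licence_lamSeven_ten_level4723`** — for `k = 10`, `l = 4723`, EVERY genuine Θ-volume datum `T` at
`(ratPoint (1/2 + 2/7^k), l)` and EVERY pair of realising Θ- and q-ideles, abc-iut-c312-1's `Thm311ToCor312.Licence` HOLDS at
`settingPrVolSharp (pilotDataOfK T.D T.K) …`; **`WRow.exists_qPinned_and_hull_lamSeven_ten_level4723`** — branch C's «∃ ρ qK, QPinned ∧ PilotKummerCompatHull»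
there, any columns. READING (neutral; numbers, not adjectives): with p508090 and p507080 the HEX class `k = 10` is decided AS TYPED at EVERY prime
`l ≥ 11`, NO exception: ¬S_H ∀T for `11 ≤ l ≤ 4721`, S_H ∀T for every prime `l ≥ 4723`. Admissibility / (P6) / Szpiro-badness of `(ratPoint λ_10, l)`
and NON-EMPTINESS of the datum type are NOT claimed. HONEST SCOPE: OUR sharp containers; STRONGER-THAN-PRINT hull reading; nothing about the printed
inequality or any author's intended hull; typed ≠ proved; instantiated ≠ endorsed; no abc claim.
[cite: Mochizuki2012, IUTchI Def. 3.1 (b),(c) pp. 61–62, Rmk. 3.1.5 p. 65, Ex. 3.2 (iv) p. 71; IUTchIII Cor. 3.12 Step (xi-f) p. 184; IUTchIV Prop. 1.1 p. 9, Prop. 1.2 (i)(ii) p. 10, Prop. 1.4 (ii) p. 13, Cor. 2.2 (ii) proof (P5) p. 46]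
[cite: DupuyHilado2025, §3.3, §3.4, §4.9, §4.12] [cite: NeukirchANT1999, Ch. II (5.5)–(5.7)] [claim: Mochizuki2012, status: disputed] for every IUT sentence.
-/

noncomputable section

open Set Function Metric NumberField IsDedekindDomain

namespace Summit.ABC.IUTFork.Conditional

open Thm311 Thm311.Real Cor312 Cor312Vol Cor312Prov Literature.IUT.LogThetaLattice Literature.IUT.LogVolume
  Literature.IUT.HodgeTheaters Literature.IUT.LogVolume.Cor22
open Literature.NumberTheory.NumberFields Literature.NumberTheory.GaloisRepresentations.Ultrametric
open Literature.NumberTheory.DiophantineGeometry Literature.NumberTheory.DiophantineGeometry.GenEll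

/-! ## The cell over `7` at `l = 4723`, `n = 1` (`e = 14169`), CEILING slot `⌈e/6⌉ = 2362` -/

/-- The socket's integer cell over `7` for the `λ_10` triple at the level `l = 4723`, index `e = 3·l = 14169` (`n = 1`), `P = 30`, `D = e − 1 = 14168`,
inner radius the CEILING `⌈e/6⌉ = 2362` (`6 ∤ e`), `ρout = min(7^4 − 4e, 7^5 − 5e) = −54275`: floor-free and convex on the labels `j ≤ 2360`
(`InhBand.quad_nonpos_of_ends 30 (−70805) (−56667) · 4721`), and the EXACT integer cell, floor included, at the top label `j = 2361`, where the floor-free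
form fails. Under the integer slot `2361` that top cell fails (abc-iut-W-num-5's record). [folklore] -/
theorem WRow.cell_hex10_p7_one_4723 (i : ℕ) (hi : i < (4723 - 1) / 2) :
    (((14169 : ℕ)) : ℤ) * ((((i + 1 : ℕ) : ℤ) ^ 2 * (((30 : ℕ)) : ℤ) - ((i + 1 : ℕ) : ℤ) * ((((14168 : ℕ)) : ℕ) : ℤ) -
        ((i + 2 : ℕ) : ℤ) * (((2362 : ℕ)) : ℤ)) / (((14169 : ℕ)) : ℤ)) +
      ((i + 2 : ℕ) : ℤ) * min (((7 : ℕ) : ℤ) ^ 4 - ((4 : ℕ) : ℤ) * (((14169 : ℕ)) : ℤ)) (((7 : ℕ) : ℤ) ^ 5 - ((5 : ℕ) : ℤ) * (((14169 : ℕ)) : ℤ)) ≤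
      (((30 : ℕ)) : ℤ) := by
  rcases Nat.lt_or_ge (i + 1) 2361 with hlt | hge
  · have he0 : (0 : ℤ) < ((14169 : ℕ) : ℤ) := by positivity
    have hfloor := Int.mul_ediv_self_le (k := ((14169 : ℕ) : ℤ))
      (x := (((i + 1 : ℕ) : ℤ) ^ 2 * (((30 : ℕ)) : ℤ) - ((i + 1 : ℕ) : ℤ) * ((((14168 : ℕ)) : ℕ) : ℤ) - ((i + 2 : ℕ) : ℤ) * (((2362 : ℕ)) : ℤ))) he0.ne'
    have hmin : min (((7 : ℕ) : ℤ) ^ 4 - ((4 : ℕ) : ℤ) * (((14169 : ℕ)) : ℤ)) (((7 : ℕ) : ℤ) ^ 5 - ((5 : ℕ) : ℤ) * (((14169 : ℕ)) : ℤ)) = -54275 := by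
      norm_num
    have hkl : 2 * ((i : ℤ) + 1) + 1 ≤ (4721 : ℤ) := by
      have h1 : 2 * (i + 1) + 1 ≤ 4721 := by omega
      exact_mod_cast h1
    have hquad := InhBand.quad_nonpos_of_ends 30 (-70805) (-56667) ((i : ℤ) + 1) 4721 (by norm_num) (by norm_num) (by linarith) hkl
      (by norm_num) (by norm_num)
    rw [hmin]
    generalize hQ : ((((i + 1 : ℕ) : ℤ) ^ 2 * (((30 : ℕ)) : ℤ) - ((i + 1 : ℕ) : ℤ) * ((((14168 : ℕ)) : ℕ) : ℤ) - ((i + 2 : ℕ) : ℤ) * (((2362 : ℕ)) : ℤ))) /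
      (((14169 : ℕ)) : ℤ) = Q at hfloor ⊢
    push_cast at hfloor hquad ⊢
    linarith [hfloor, hquad]
  · obtain rfl : i = 2360 := by omega
    norm_num

/-! ## The arithmetic of the CEILING-slot socket at `l = 4723` -/

/-- **The ceiling socket's arithmetic hypothesis `hcell` for `(282475253, 282475245, 564950498)` at the level `l = 4723`.** Per prime of `abc` other than
`2, l`: the divisibilities the socket hands over force `e = m_p·l·n` (`n ≥ 1`), `e` is off the cyclotomic indices, and with the exponents of
abc-iut-C-cert-1's `WRow.hcell_lamSeven_ten_all` (`A_7 = 4`, `B_7 = 5`, `A = 0`, `B = 1` elsewhere) the cells hold at every label `j ≤ 2361`: over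
`3, 5, 13, 113, 431, 3361, 2499781` the integer-slot cells (`WRow.cell_wild_of_ends` / `WRow.cell_tameslot_of_ends`, numeric ends) transported to the
ceiling (`WRow.cell_of_le_rin`, `WRow.max_one_div_le_ceilSlot`); over `7`: `n ≥ 2` the same from `n₀ = 2`, `n = 1` by `WRow.cell_hex10_p7_one_4723`
(ceiling `2362`, exact top-label cell). [folklore] -/
theorem WRow.hcell_lamSeven_ten_ceil_4723 {l : ℕ} (hl4723 : l = 4723) :
    ∀ p : ℕ, p.Prime → p ∣ 282475253 * 282475245 * 564950498 → p ≠ 2 → p ≠ l → ∀ e : ℕ, 0 < e → l ∣ e →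
      15 * l ∣ e * (282475253 * 282475245 * 564950498).factorization p → (p ∣ 30 → (p - 1) ∣ e) →
      (p ∣ 564950498 → Odd ((282475253 * 282475245 * 564950498).factorization p) → 30 * l ∣ e * (282475253 * 282475245 * 564950498).factorization p) →
      (∀ k : ℕ, (e : ℤ) ≠ (p : ℤ) ^ k * ((p : ℤ) - 1)) ∧
      ∀ i : ℕ, i < (l - 1) / 2 →
        (e : ℤ) * ((((i + 1 : ℕ) : ℤ) ^ 2 * ((e * (2 * (282475253 * 282475245 * 564950498).factorization p) / (2 * l) : ℕ) : ℤ) -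
            ((i + 1 : ℕ) : ℤ) * (((if p ∣ 30 ∧ ¬ p ∣ (282475253 * 282475245 * 564950498).factorization p then 2 * e - 1 else e - 1 : ℕ) : ℕ) : ℤ) -
            ((i + 2 : ℕ) : ℤ) * ((((e + (p - 2)) / (p - 1) : ℕ) : ℤ))) / (e : ℤ)) +
          ((i + 2 : ℕ) : ℤ) * min ((p : ℤ) ^ (if p = 7 then 4 else 0) - ((if p = 7 then 4 else 0 : ℕ) : ℤ) * (e : ℤ))
            ((p : ℤ) ^ (if p = 7 then 5 else 1) - ((if p = 7 then 5 else 1 : ℕ) : ℤ) * (e : ℤ)) ≤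
        ((e * (2 * (282475253 * 282475245 * 564950498).factorization p) / (2 * l) : ℕ) : ℤ) := by
  subst hl4723
  have hl : Nat.Prime 4723 := by norm_num
  intro p hp hpabc h2 hpl e he _hle h15 h30 hodd
  rcases eq_of_prime_dvd_triple_hex10 hp hpabc with rfl | rfl | rfl | rfl | rfl | rfl | rfl | rfl | rfl
  · exact absurd rfl h2
  · -- `p = 3`: `v_3(abc) = 1`, admissible `e = 30·l·n`, `A = 0`, shape wild
    rw [factorization_triple_hex10.1] at h15 hodd ⊢
    have hA : 15 * 4723 ∣ e := by simpa using h15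
    have hq : 2 ∣ e := by have := h30 (by norm_num); norm_num at this; exact this
    have he0 : 30 * 4723 ∣ e := by
      have := Nat.Coprime.mul_dvd_of_dvd_of_dvd (by norm_num : Nat.Coprime 2 (15 * 4723)) hq hA
      rwa [← mul_assoc] at this
    obtain ⟨n, rfl⟩ := he0
    have hn : 1 ≤ n := Nat.pos_of_ne_zero (by rintro rfl; simp at he)
    refine ⟨WRow.natCast_ne_pow_mul_sub_one (by norm_num : Nat.Prime 5) (by norm_num) (by norm_num) (by norm_num)
      ⟨6 * 4723 * n, by ring⟩, fun i hi => ?_⟩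
    refine WRow.cell_of_le_rin (by positivity) (show (((max 1 (30 * 4723 * n / (3 - 1))) : ℕ) : ℤ) ≤ (((30 * 4723 * n + (3 - 2)) / (3 - 1) : ℕ) : ℤ) from
      by exact_mod_cast WRow.max_one_div_le_ceilSlot (by norm_num) he) ?_
    have hmax : 1 ≤ 30 * 4723 * n / (3 - 1) := (Nat.le_div_iff_mul_le (by norm_num)).mpr (by omega)
    rw [if_pos ⟨by norm_num, by norm_num⟩, max_eq_right hmax]
    simp only [show ((3 : ℕ) = 7) = False from eq_false (by decide), ite_false]
    refine WRow.cell_wild_of_ends ((3 : ℕ) : ℤ) (30 * 4723) (3 - 1) (2 * 1) (2 * 4723) 0 1 ((4723 - 1) / 2) (by norm_num) (by norm_num)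
      (by norm_num) (by norm_num) (by norm_num) (by norm_num) ?_ hi hn
    rintro i (rfl | hi')
    · norm_num
    · obtain rfl : i = 2360 := by omega
      norm_num
  · -- `p = 5`: `v_5(abc) = 1`, admissible `e = 60·l·n`, `A = 0`, shape wild
    rw [factorization_triple_hex10.2.1] at h15 hodd ⊢
    have hA : 15 * 4723 ∣ e := by simpa using h15
    have hq : 4 ∣ e := by have := h30 (by norm_num); norm_num at this; exact this
    have he0 : 60 * 4723 ∣ e := by
      have := Nat.Coprime.mul_dvd_of_dvd_of_dvd (by norm_num : Nat.Coprime 4 (15 * 4723)) hq hA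
      rwa [← mul_assoc] at this
    obtain ⟨n, rfl⟩ := he0
    have hn : 1 ≤ n := Nat.pos_of_ne_zero (by rintro rfl; simp at he)
    refine ⟨WRow.natCast_ne_pow_mul_sub_one (by norm_num : Nat.Prime 3) (by norm_num) (by norm_num) (by norm_num)
      ⟨20 * 4723 * n, by ring⟩, fun i hi => ?_⟩
    refine WRow.cell_of_le_rin (by positivity) (show (((max 1 (60 * 4723 * n / (5 - 1))) : ℕ) : ℤ) ≤ (((60 * 4723 * n + (5 - 2)) / (5 - 1) : ℕ) : ℤ) from
      by exact_mod_cast WRow.max_one_div_le_ceilSlot (by norm_num) he) ?_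
    have hmax : 1 ≤ 60 * 4723 * n / (5 - 1) := (Nat.le_div_iff_mul_le (by norm_num)).mpr (by omega)
    rw [if_pos ⟨by norm_num, by norm_num⟩, max_eq_right hmax]
    simp only [show ((5 : ℕ) = 7) = False from eq_false (by decide), ite_false]
    refine WRow.cell_wild_of_ends ((5 : ℕ) : ℤ) (60 * 4723) (5 - 1) (2 * 1) (2 * 4723) 0 1 ((4723 - 1) / 2) (by norm_num) (by norm_num)
      (by norm_num) (by norm_num) (by norm_num) (by norm_num) ?_ hi hn
    rintro i (rfl | hi')
    · norm_num
    · obtain rfl : i = 2360 := by omega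
      norm_num
  · -- `p = 7`: `v_7(abc) = 10`, admissible `e = 3·l·n`, `A = 4`, `B = 5`, shape tame; CEILING slot
    rw [factorization_triple_hex10.2.2.1] at h15 hodd ⊢
    have h15' : 3 * 4723 * 5 ∣ e * 2 * 5 := by
      rw [show 3 * 4723 * 5 = 15 * 4723 by norm_num, show e * 2 * 5 = e * 10 by ring]; exact h15
    have hA : 3 * 4723 ∣ e :=
      (by norm_num : Nat.Coprime (3 * 4723) 2).dvd_of_dvd_mul_right (Nat.dvd_of_mul_dvd_mul_right (by norm_num) h15')
    obtain ⟨n, rfl⟩ := hA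
    have hn : 1 ≤ n := Nat.pos_of_ne_zero (by rintro rfl; simp at he)
    refine ⟨WRow.natCast_ne_pow_mul_sub_one hl (by norm_num : Nat.Prime 7) (by norm_num) (by norm_num) ⟨3 * n, by ring⟩, fun i hi => ?_⟩
    rw [if_neg (by norm_num : ¬ ((7 : ℕ) ∣ 30 ∧ ¬ (7 : ℕ) ∣ 10))]
    simp only [ite_true]
    rcases Nat.lt_or_ge n 2 with hn2 | hn2
    · -- `n = 1`: the level cell with the EXACT top label under the ceiling `2362`
      obtain rfl : n = 1 := by omega
      have hP : (3 * 4723 * 1 * (2 * 10) / (2 * 4723) : ℕ) = 30 := by norm_num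
      have hD : (3 * 4723 * 1 - 1 : ℕ) = 14168 := by norm_num
      have hR : ((3 * 4723 * 1 + (7 - 2)) / (7 - 1) : ℕ) = 2362 := by norm_num
      have hE : (3 * 4723 * 1 : ℕ) = 14169 := by norm_num
      rw [hP, hD, hR, hE]
      exact WRow.cell_hex10_p7_one_4723 i hi
    · -- `n ≥ 2`: floor-free from `n₀ = 2` under the integer slot, transported to the ceiling
      refine WRow.cell_of_le_rin (by positivity) (show (((max 1 (3 * 4723 * n / (7 - 1))) : ℕ) : ℤ) ≤ (((3 * 4723 * n + (7 - 2)) / (7 - 1) : ℕ) : ℤ) from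
        by exact_mod_cast WRow.max_one_div_le_ceilSlot (by norm_num) he) ?_
      refine WRow.cell_tameslot_of_ends ((7 : ℕ) : ℤ) (3 * 4723) (7 - 1) (3 * 4723 / 6) (2 * 10) (2 * 4723) 4 5 ((4723 - 1) / 2) 2 (by norm_num)
        (by norm_num) (by norm_num) (by norm_num) (by norm_num) (by norm_num) (by norm_num) ?_ hi hn2
      rintro i (rfl | hi')
      · norm_num
      · obtain rfl : i = 2360 := by omega
        norm_num
  · -- `p = 13`: `v_13(abc) = 1`, admissible `e = 15·l·n`, `A = 0`, shape tame
    rw [factorization_triple_hex10.2.2.2.1] at h15 hodd ⊢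
    have hA : 15 * 4723 ∣ e := by simpa using h15
    obtain ⟨n, rfl⟩ := hA
    have hn : 1 ≤ n := Nat.pos_of_ne_zero (by rintro rfl; simp at he)
    refine ⟨WRow.natCast_ne_pow_mul_sub_one (by norm_num : Nat.Prime 5) (by norm_num) (by norm_num) (by norm_num)
      ⟨3 * 4723 * n, by ring⟩, fun i hi => ?_⟩
    refine WRow.cell_of_le_rin (by positivity) (show (((max 1 (15 * 4723 * n / (13 - 1))) : ℕ) : ℤ) ≤ (((15 * 4723 * n + (13 - 2)) / (13 - 1) : ℕ) : ℤ) from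
      by exact_mod_cast WRow.max_one_div_le_ceilSlot (by norm_num) he) ?_
    rw [if_neg (by norm_num : ¬ ((13 : ℕ) ∣ 30 ∧ ¬ (13 : ℕ) ∣ 1))]
    simp only [show ((13 : ℕ) = 7) = False from eq_false (by decide), ite_false]
    refine WRow.cell_tameslot_of_ends ((13 : ℕ) : ℤ) (15 * 4723) (13 - 1) 0 (2 * 1) (2 * 4723) 0 1 ((4723 - 1) / 2) 1 (by norm_num) (by norm_num)
      (by norm_num) (by norm_num) (by norm_num) (by norm_num) le_rfl ?_ hi hn
    rintro i (rfl | hi')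
    · norm_num
    · obtain rfl : i = 2360 := by omega
      norm_num
  · -- `p = 113`: `v_113(abc) = 1`, admissible `e = 15·l·n`, `A = 0`, shape tame
    rw [factorization_triple_hex10.2.2.2.2.1] at h15 hodd ⊢
    have hA : 15 * 4723 ∣ e := by simpa using h15
    obtain ⟨n, rfl⟩ := hA
    have hn : 1 ≤ n := Nat.pos_of_ne_zero (by rintro rfl; simp at he)
    refine ⟨WRow.natCast_ne_pow_mul_sub_one (by norm_num : Nat.Prime 5) (by norm_num) (by norm_num) (by norm_num)
      ⟨3 * 4723 * n, by ring⟩, fun i hi => ?_⟩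
    refine WRow.cell_of_le_rin (by positivity) (show (((max 1 (15 * 4723 * n / (113 - 1))) : ℕ) : ℤ) ≤ (((15 * 4723 * n + (113 - 2)) / (113 - 1) : ℕ) : ℤ) from
      by exact_mod_cast WRow.max_one_div_le_ceilSlot (by norm_num) he) ?_
    rw [if_neg (by norm_num : ¬ ((113 : ℕ) ∣ 30 ∧ ¬ (113 : ℕ) ∣ 1))]
    simp only [show ((113 : ℕ) = 7) = False from eq_false (by decide), ite_false]
    refine WRow.cell_tameslot_of_ends ((113 : ℕ) : ℤ) (15 * 4723) (113 - 1) 0 (2 * 1) (2 * 4723) 0 1 ((4723 - 1) / 2) 1 (by norm_num) (by norm_num)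
      (by norm_num) (by norm_num) (by norm_num) (by norm_num) le_rfl ?_ hi hn
    rintro i (rfl | hi')
    · norm_num
    · obtain rfl : i = 2360 := by omega
      norm_num
  · -- `p = 431`: `v_431(abc) = 1`, admissible `e = 15·l·n`, `A = 0`, shape tame
    rw [factorization_triple_hex10.2.2.2.2.2.1] at h15 hodd ⊢
    have hA : 15 * 4723 ∣ e := by simpa using h15
    obtain ⟨n, rfl⟩ := hA
    have hn : 1 ≤ n := Nat.pos_of_ne_zero (by rintro rfl; simp at he)
    refine ⟨WRow.natCast_ne_pow_mul_sub_one (by norm_num : Nat.Prime 3) (by norm_num) (by norm_num) (by norm_num)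
      ⟨5 * 4723 * n, by ring⟩, fun i hi => ?_⟩
    refine WRow.cell_of_le_rin (by positivity) (show (((max 1 (15 * 4723 * n / (431 - 1))) : ℕ) : ℤ) ≤ (((15 * 4723 * n + (431 - 2)) / (431 - 1) : ℕ) : ℤ) from
      by exact_mod_cast WRow.max_one_div_le_ceilSlot (by norm_num) he) ?_
    rw [if_neg (by norm_num : ¬ ((431 : ℕ) ∣ 30 ∧ ¬ (431 : ℕ) ∣ 1))]
    simp only [show ((431 : ℕ) = 7) = False from eq_false (by decide), ite_false]
    refine WRow.cell_tameslot_of_ends ((431 : ℕ) : ℤ) (15 * 4723) (431 - 1) 0 (2 * 1) (2 * 4723) 0 1 ((4723 - 1) / 2) 1 (by norm_num) (by norm_num)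
      (by norm_num) (by norm_num) (by norm_num) (by norm_num) le_rfl ?_ hi hn
    rintro i (rfl | hi')
    · norm_num
    · obtain rfl : i = 2360 := by omega
      norm_num
  · -- `p = 3361`: `v_3361(abc) = 1`, admissible `e = 15·l·n`, `A = 0`, shape tame
    rw [factorization_triple_hex10.2.2.2.2.2.2.1] at h15 hodd ⊢
    have hA : 15 * 4723 ∣ e := by simpa using h15
    obtain ⟨n, rfl⟩ := hA
    have hn : 1 ≤ n := Nat.pos_of_ne_zero (by rintro rfl; simp at he)
    refine ⟨WRow.natCast_ne_pow_mul_sub_one hl (by norm_num : Nat.Prime 3361) (by norm_num) (by norm_num) ⟨15 * n, by ring⟩, fun i hi => ?_⟩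
    refine WRow.cell_of_le_rin (by positivity) (show (((max 1 (15 * 4723 * n / (3361 - 1))) : ℕ) : ℤ) ≤ (((15 * 4723 * n + (3361 - 2)) / (3361 - 1) : ℕ) : ℤ) from
      by exact_mod_cast WRow.max_one_div_le_ceilSlot (by norm_num) he) ?_
    rw [if_neg (by norm_num : ¬ ((3361 : ℕ) ∣ 30 ∧ ¬ (3361 : ℕ) ∣ 1))]
    simp only [show ((3361 : ℕ) = 7) = False from eq_false (by decide), ite_false]
    refine WRow.cell_tameslot_of_ends ((3361 : ℕ) : ℤ) (15 * 4723) (3361 - 1) 0 (2 * 1) (2 * 4723) 0 1 ((4723 - 1) / 2) 1 (by norm_num) (by norm_num)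
      (by norm_num) (by norm_num) (by norm_num) (by norm_num) le_rfl ?_ hi hn
    rintro i (rfl | hi')
    · norm_num
    · obtain rfl : i = 2360 := by omega
      norm_num
  · -- `p = 2499781`: `v_2499781(abc) = 1`, admissible `e = 15·l·n`, `A = 0`, shape tame
    rw [factorization_triple_hex10.2.2.2.2.2.2.2] at h15 hodd ⊢
    have hA : 15 * 4723 ∣ e := by simpa using h15
    obtain ⟨n, rfl⟩ := hA
    have hn : 1 ≤ n := Nat.pos_of_ne_zero (by rintro rfl; simp at he)
    refine ⟨WRow.natCast_ne_pow_mul_sub_one hl (by norm_num : Nat.Prime 2499781) (by norm_num) (by norm_num) ⟨15 * n, by ring⟩, fun i hi => ?_⟩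
    refine WRow.cell_of_le_rin (by positivity)
      (show (((max 1 (15 * 4723 * n / (2499781 - 1))) : ℕ) : ℤ) ≤ (((15 * 4723 * n + (2499781 - 2)) / (2499781 - 1) : ℕ) : ℤ) from
      by exact_mod_cast WRow.max_one_div_le_ceilSlot (by norm_num) he) ?_
    rw [if_neg (by norm_num : ¬ ((2499781 : ℕ) ∣ 30 ∧ ¬ (2499781 : ℕ) ∣ 1))]
    simp only [show ((2499781 : ℕ) = 7) = False from eq_false (by decide), ite_false]
    refine WRow.cell_tameslot_of_ends ((2499781 : ℕ) : ℤ) (15 * 4723) (2499781 - 1) 0 (2 * 1) (2 * 4723) 0 1 ((4723 - 1) / 2) 1 (by norm_num)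
      (by norm_num) (by norm_num) (by norm_num) (by norm_num) (by norm_num) le_rfl ?_ hi hn
    rintro i (rfl | hi')
    · norm_num
    · obtain rfl : i = 2360 := by omega
      norm_num

/-! ## THE LEVEL: S_H INHABITED at every genuine datum over `(ratPoint λ_10, 4723)`, `λ_10 = 1/2 + 2/7¹⁰` -/

/-- **«OPEN-SINGLE-PRIMES», HEX `k = 10` at the level `l = 4723`**: every genuine Θ-volume datum `T` at `(ratPoint (1/2 + 2/7^10), 4723)`
([IUTchIV] Cor. 2.2 (ii) proof (P7); abc-iut-w5-d044's HEX family) and every pair of Θ- and q-ideles realising the pilot divisors of `X := pilotDataOfK T.D T.K`, abc-iut-c312-1's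
`Thm311ToCor312.Licence` HOLDS at abc-iut-c312-7's `settingPrVolSharp X …` — this seat's CEILING-slot socket `WRow.licence_triple_unconditional_ceil` at `WRow.hcell_lamSeven_ten_ceil_4723`,
transported along abc-iut-C-cert-1's `lamSeven_eq_hex10`. With p508090 (¬S_H, `11 ≤ l ≤ 4721`) and p507080 (S_H, `l ≥ 4729`) the `k = 10` axis carries no exception.
[cite: Mochizuki2012, IUTchI Def. 3.1 (b),(c) pp. 61–62, Rmk. 3.1.5 p. 65, Ex. 3.2 (iv) p. 71; IUTchIII Cor. 3.12 Step (xi-f) p. 184; IUTchIV Prop. 1.1 p. 9, Prop. 1.2 (i)(ii) p. 10, Prop. 1.4 (ii) p. 13, Cor. 2.2 (ii) proof (P5) p. 46] [cite: DupuyHilado2025, §3.3, §3.4, §4.9, §4.12] [claim: Mochizuki2012, status: disputed] -/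
theorem WRow.licence_lamSeven_ten_level4723 {k l : ℕ} (hk : k = 10) (hl : l = 4723) (T : Cor22.ThetaVolumeDatumAt (ratPoint ((2 : ℚ)⁻¹ + 2 / 7 ^ k)) l) :
    letI := T.instFieldF; letI := T.instNumberFieldF; letI := T.instAlgebraF; letI := T.instFieldK
    letI := T.instNumberFieldK; letI := T.instAlgebraK; letI := T.instFieldFbar; letI := T.instAlgebraFbar
    letI := T.instAlgebraKFbar; letI := T.instIsElliptic
    ∀ {logv : PadicLogs T.K} (hlog : LogvAnalytic logv) (M : Type) [Field M] [NumberField M]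
      (archPk : ∀ (j : (thetaIndex (pilotDataOfK T.D T.K)).Label) (vQ : (thetaIndex (pilotDataOfK T.D T.K)).VQ),
        Set ((logShellsDH (pilotDataOfK T.D T.K) logv).Packet j vQ))
      (archSub : ∀ (j : (thetaIndex (pilotDataOfK T.D T.K)).Label) (v : (thetaIndex (pilotDataOfK T.D T.K)).V),
        Set ((logShellsDH (pilotDataOfK T.D T.K) logv).Packet j ((thetaIndex (pilotDataOfK T.D T.K)).over v)))
      (Ψ : ℤ → ∀ v : (thetaIndex (pilotDataOfK T.D T.K)).V, v ∈ (thetaIndex (pilotDataOfK T.D T.K)).Vbad →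
        Set ((logShellsDH (pilotDataOfK T.D T.K) logv).StarPacket v))
      (act : ℤ → ∀ v : (thetaIndex (pilotDataOfK T.D T.K)).V, v ∈ (thetaIndex (pilotDataOfK T.D T.K)).Vbad →
        (logShellsDH (pilotDataOfK T.D T.K) logv).StarPacket v → Module.End ℚ ((logShellsDH (pilotDataOfK T.D T.K) logv).StarPacket v))
      (Mmod : ℤ → ∀ j : (thetaIndex (pilotDataOfK T.D T.K)).LabelStar, Set ((logShellsDH (pilotDataOfK T.D T.K) logv).GlobalPacket j.1))
      (region : ℤ → ∀ j : (thetaIndex (pilotDataOfK T.D T.K)).LabelStar, FinDivisor M → ∀ vQ : (thetaIndex (pilotDataOfK T.D T.K)).VQ,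
        Set ((logShellsDH (pilotDataOfK T.D T.K) logv).Packet j.1 vQ))
      (n : ℤ) {HT : Type} {LogLink : HT → HT → Type} {IsFull : ∀ {s t : HT}, LogLink s t → Prop}
      (lat : LGPGaussianLogThetaLattice LogLink IsFull)
      {Frd : Type} {IsoF : Frd → Frd → Type} {Ob : Frd → Type} {realify : Frd → Frd} {Strip : Type}
      {IsoS : Strip → Strip → Type} {Mv : ∀ v : (thetaIndex (pilotDataOfK T.D T.K)).V, v ∈ (thetaIndex (pilotDataOfK T.D T.K)).Vbad → Type}
      [∀ v h, Monoid (Mv v h)]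
      (sig : GlobalLGPFrobenioidSignature (thetaIndex (pilotDataOfK T.D T.K)).lstar (thetaIndex (pilotDataOfK T.D T.K)).V
        (· ∈ (thetaIndex (pilotDataOfK T.D T.K)).Vbad) Frd IsoF Ob realify Strip IsoS Mv)
      (split : SplittingMonoids Mv) {ObΔ : Type} {N : ∀ v : (thetaIndex (pilotDataOfK T.D T.K)).V, v ∈ (thetaIndex (pilotDataOfK T.D T.K)).Vbad → Type}
      [∀ v h, Monoid (N v h)] (qData : QPilotData ObΔ N)
      (tq : ∀ (pp : Nat.Primes) (x : (thetaIndex (pilotDataOfK T.D T.K)).Fibre (.inr pp)),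
        haveI : Fact (pp : ℕ).Prime := ⟨pp.2⟩; kOf (pilotDataOfK T.D T.K) pp.1 x)
      (t : ∀ (pp : Nat.Primes) (_ : Fin (pilotDataOfK T.D T.K).lstar) (x : (thetaIndex (pilotDataOfK T.D T.K)).Fibre (.inr pp)),
        haveI : Fact (pp : ℕ).Prime := ⟨pp.2⟩; kOf (pilotDataOfK T.D T.K) pp.1 x)
      (htq0 : ∀ pp x, tq pp x ≠ 0)
      (htq1 : ∀ (pp : Nat.Primes) (x : (thetaIndex (pilotDataOfK T.D T.K)).Fibre (.inr pp)),
        haveI : Fact (pp : ℕ).Prime := ⟨pp.2⟩; placeOf (pilotDataOfK T.D T.K) pp.1 x ∉ (pilotDataOfK T.D T.K).S → ‖tq pp x‖ = 1)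
      (_ht0 : ∀ pp i x, t pp i x ≠ 0)
      (_ht : ∀ (pp : Nat.Primes) (i : Fin (pilotDataOfK T.D T.K).lstar) (x : (thetaIndex (pilotDataOfK T.D T.K)).Fibre (.inr pp)),
        haveI : Fact (pp : ℕ).Prime := ⟨pp.2⟩
        Real.log ‖t pp i x‖ = -((pilotDataOfK T.D T.K).thetaPilot i (placeOf (pilotDataOfK T.D T.K) pp.1 x)) *
          logNorm T.K (placeOf (pilotDataOfK T.D T.K) pp.1 x) / localDegree T.K (placeOf (pilotDataOfK T.D T.K) pp.1 x))
      (_htq : ∀ (pp : Nat.Primes) (x : (thetaIndex (pilotDataOfK T.D T.K)).Fibre (.inr pp)),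
        haveI : Fact (pp : ℕ).Prime := ⟨pp.2⟩
        Real.log ‖tq pp x‖ = -((pilotDataOfK T.D T.K).qPilot (placeOf (pilotDataOfK T.D T.K) pp.1 x)) *
          logNorm T.K (placeOf (pilotDataOfK T.D T.K) pp.1 x) / localDegree T.K (placeOf (pilotDataOfK T.D T.K) pp.1 x)),
      Thm311ToCor312.Licence
        (settingPrVolSharp (pilotDataOfK T.D T.K) hlog M archPk archSub Ψ act Mmod region n lat sig split qData tq t htq0 htq1) := by
  subst hk
  revert T
  rw [lamSeven_eq_hex10]
  intro T
  exact WRow.licence_triple_unconditional_ceil isABCTriple_hex10 (by rw [Cor22.jInv_ratPoint_triple isABCTriple_hex10]; norm_num) T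
    (fun p => if p = 7 then 4 else 0) (fun p => if p = 7 then 5 else 1) (WRow.hcell_lamSeven_ten_ceil_4723 hl)

/-- **BRANCH C's PER-DATUM ANTECEDENT «∃ ρ qK, QPinned ∧ PilotKummerCompatHull» at every genuine datum over `(ratPoint (1/2 + 2/7^10), 4723)`** (any columns
`col`; every pair of realising Θ- and q-ideles, the CHOSEN ones of the window certificates' `hSHw`/`hSHwBad` binders included): the per-datum S_H object of the
certificates of record (p453137 / p450130 / p447945) HOLDS at this datum class, UNCONDITIONALLY, under the CEILING inner slot.
[cite: Mochizuki2012, IUTchIII Cor. 3.12 Step (xi-d) p. 183, (xi-f) p. 184] [cite: DupuyHilado2025, §3.3, §3.4, §4.9] [claim: Mochizuki2012, status: disputed] -/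
theorem WRow.exists_qPinned_and_hull_lamSeven_ten_level4723 {k l : ℕ} (hk : k = 10) (hl : l = 4723) (T : Cor22.ThetaVolumeDatumAt (ratPoint ((2 : ℚ)⁻¹ + 2 / 7 ^ k)) l) :
    letI := T.instFieldF; letI := T.instNumberFieldF; letI := T.instAlgebraF; letI := T.instFieldK
    letI := T.instNumberFieldK; letI := T.instAlgebraK; letI := T.instFieldFbar; letI := T.instAlgebraFbar
    letI := T.instAlgebraKFbar; letI := T.instIsElliptic
    ∀ {logv : PadicLogs T.K} (hlog : LogvAnalytic logv) (M : Type) [Field M] [NumberField M]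
      (archPk : ∀ (j : (thetaIndex (pilotDataOfK T.D T.K)).Label) (vQ : (thetaIndex (pilotDataOfK T.D T.K)).VQ),
        Set ((logShellsDH (pilotDataOfK T.D T.K) logv).Packet j vQ))
      (archSub : ∀ (j : (thetaIndex (pilotDataOfK T.D T.K)).Label) (v : (thetaIndex (pilotDataOfK T.D T.K)).V),
        Set ((logShellsDH (pilotDataOfK T.D T.K) logv).Packet j ((thetaIndex (pilotDataOfK T.D T.K)).over v)))
      (Ψ : ℤ → ∀ v : (thetaIndex (pilotDataOfK T.D T.K)).V, v ∈ (thetaIndex (pilotDataOfK T.D T.K)).Vbad →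
        Set ((logShellsDH (pilotDataOfK T.D T.K) logv).StarPacket v))
      (act : ℤ → ∀ v : (thetaIndex (pilotDataOfK T.D T.K)).V, v ∈ (thetaIndex (pilotDataOfK T.D T.K)).Vbad →
        (logShellsDH (pilotDataOfK T.D T.K) logv).StarPacket v → Module.End ℚ ((logShellsDH (pilotDataOfK T.D T.K) logv).StarPacket v))
      (Mmod : ℤ → ∀ j : (thetaIndex (pilotDataOfK T.D T.K)).LabelStar, Set ((logShellsDH (pilotDataOfK T.D T.K) logv).GlobalPacket j.1))
      (region : ℤ → ∀ j : (thetaIndex (pilotDataOfK T.D T.K)).LabelStar, FinDivisor M → ∀ vQ : (thetaIndex (pilotDataOfK T.D T.K)).VQ,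
        Set ((logShellsDH (pilotDataOfK T.D T.K) logv).Packet j.1 vQ))
      (n : ℤ) {HT : Type} {LogLink : HT → HT → Type} {IsFull : ∀ {s t : HT}, LogLink s t → Prop}
      (lat : LGPGaussianLogThetaLattice LogLink IsFull)
      {Frd : Type} {IsoF : Frd → Frd → Type} {Ob : Frd → Type} {realify : Frd → Frd} {Strip : Type}
      {IsoS : Strip → Strip → Type} {Mv : ∀ v : (thetaIndex (pilotDataOfK T.D T.K)).V, v ∈ (thetaIndex (pilotDataOfK T.D T.K)).Vbad → Type}
      [∀ v h, Monoid (Mv v h)]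
      (sig : GlobalLGPFrobenioidSignature (thetaIndex (pilotDataOfK T.D T.K)).lstar (thetaIndex (pilotDataOfK T.D T.K)).V
        (· ∈ (thetaIndex (pilotDataOfK T.D T.K)).Vbad) Frd IsoF Ob realify Strip IsoS Mv)
      (split : SplittingMonoids Mv) {ObΔ : Type} {N : ∀ v : (thetaIndex (pilotDataOfK T.D T.K)).V, v ∈ (thetaIndex (pilotDataOfK T.D T.K)).Vbad → Type}
      [∀ v h, Monoid (N v h)] (qData : QPilotData ObΔ N)
      (tq : ∀ (pp : Nat.Primes) (x : (thetaIndex (pilotDataOfK T.D T.K)).Fibre (.inr pp)),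
        haveI : Fact (pp : ℕ).Prime := ⟨pp.2⟩; kOf (pilotDataOfK T.D T.K) pp.1 x)
      (t : ∀ (pp : Nat.Primes) (_ : Fin (pilotDataOfK T.D T.K).lstar) (x : (thetaIndex (pilotDataOfK T.D T.K)).Fibre (.inr pp)),
        haveI : Fact (pp : ℕ).Prime := ⟨pp.2⟩; kOf (pilotDataOfK T.D T.K) pp.1 x)
      (htq0 : ∀ pp x, tq pp x ≠ 0)
      (htq1 : ∀ (pp : Nat.Primes) (x : (thetaIndex (pilotDataOfK T.D T.K)).Fibre (.inr pp)),
        haveI : Fact (pp : ℕ).Prime := ⟨pp.2⟩; placeOf (pilotDataOfK T.D T.K) pp.1 x ∉ (pilotDataOfK T.D T.K).S → ‖tq pp x‖ = 1)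
      (col : ℤ → Column (logShellsDH (pilotDataOfK T.D T.K) logv))
      (_ht0 : ∀ pp i x, t pp i x ≠ 0)
      (_ht : ∀ (pp : Nat.Primes) (i : Fin (pilotDataOfK T.D T.K).lstar) (x : (thetaIndex (pilotDataOfK T.D T.K)).Fibre (.inr pp)),
        haveI : Fact (pp : ℕ).Prime := ⟨pp.2⟩
        Real.log ‖t pp i x‖ = -((pilotDataOfK T.D T.K).thetaPilot i (placeOf (pilotDataOfK T.D T.K) pp.1 x)) *
          logNorm T.K (placeOf (pilotDataOfK T.D T.K) pp.1 x) / localDegree T.K (placeOf (pilotDataOfK T.D T.K) pp.1 x))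
      (_htq : ∀ (pp : Nat.Primes) (x : (thetaIndex (pilotDataOfK T.D T.K)).Fibre (.inr pp)),
        haveI : Fact (pp : ℕ).Prime := ⟨pp.2⟩
        Real.log ‖tq pp x‖ = -((pilotDataOfK T.D T.K).qPilot (placeOf (pilotDataOfK T.D T.K) pp.1 x)) *
          logNorm T.K (placeOf (pilotDataOfK T.D T.K) pp.1 x) / localDegree T.K (placeOf (pilotDataOfK T.D T.K) pp.1 x)),
      ∃ (ρ : (∀ v : (thetaIndex (pilotDataOfK T.D T.K)).V, v ∈ (thetaIndex (pilotDataOfK T.D T.K)).Vbad →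
              Set ((logShellsDH (pilotDataOfK T.D T.K) logv).StarPacket v)) →
            ∀ (j : (thetaIndex (pilotDataOfK T.D T.K)).Label) (vQ : (thetaIndex (pilotDataOfK T.D T.K)).VQ),
              Set ((logShellsDH (pilotDataOfK T.D T.K) logv).Packet j vQ))
          (qK : ∀ v : (thetaIndex (pilotDataOfK T.D T.K)).V, v ∈ (thetaIndex (pilotDataOfK T.D T.K)).Vbad →
            Set ((logShellsDH (pilotDataOfK T.D T.K) logv).StarPacket v)),
          QPinned ({ toSituation := situationPrVol (pilotDataOfK T.D T.K) hlog M archPk archSub Ψ act Mmod region, col := col } :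
              LatticeSituation (thetaIndex (pilotDataOfK T.D T.K)))
            (settingPrVolSharp (pilotDataOfK T.D T.K) hlog M archPk archSub Ψ act Mmod region n lat sig split qData tq t htq0 htq1) ρ qK ∧
          PilotKummerCompatHull ({ toSituation := situationPrVol (pilotDataOfK T.D T.K) hlog M archPk archSub Ψ act Mmod region, col := col } :
              LatticeSituation (thetaIndex (pilotDataOfK T.D T.K)))
            (settingPrVolSharp (pilotDataOfK T.D T.K) hlog M archPk archSub Ψ act Mmod region n lat sig split qData tq t htq0 htq1) ρ qK := by
  subst hk
  revert T
  rw [lamSeven_eq_hex10]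
  intro T
  exact WRow.exists_qPinned_and_hull_triple_unconditional_ceil isABCTriple_hex10 (by rw [Cor22.jInv_ratPoint_triple isABCTriple_hex10]; norm_num) T
    (fun p => if p = 7 then 4 else 0) (fun p => if p = 7 then 5 else 1) (WRow.hcell_lamSeven_ten_ceil_4723 hl)

end Summit.ABC.IUTFork.Conditional

end
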